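import Summits.QuantumFields.BalabanUV.T4Continuum.Support.BlockAverageDbarLinBound
import Summits.QuantumFields.BalabanUV.T4Continuum.Support.BlockAverageVaryHolo
import HarnessLib

/-!
# T⁴ programme, node NE3, row S6-Y7 (P3 leaf L7 «SLOP», k-level input (K3)) — THE TWO SHARP ONE-STEP OPERATOR BOUNDS OF THE
# LINEARISED DOUBLE-BAR AVERAGE AT A CURVED SMALL-FIELD BACKGROUND: `sup → sup ≤ L + Csup·w` and, on the torus,
# `ℓ¹ → ℓ¹ ≤ L^{1−d} + Cl1·w` (`BlockAverageDbarLinNorms`)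

Cell `pub-balaban`, NE3 formalisation swarm (`t4/formal/NE3/LEAVES.md` row S5∕S6, sub-row S6-Y7; unit
`b2b-balaban-t4-ne3-formalise-leaf-10`, gen 2); sequel of `BlockAverageDbarLinBound` (pointwise structure
`‖dbarLin c‖ ≤ segL1 + w·(1250(loopL1 + ℓ_Γ) + 8 treeL1′ + 2 ℓ_Γ)` on `U(N)` data with loop variables within `w ≤ 1∕32` of `1`).
THIS FILE sums the local `ℓ¹` weights: §1 word weights against the sup and against box sums (`lnorm_le_length_mul_sup`, tree
`AveragingDeficitPlaqLin.lnorm_le_region`), the straight segment exactly (`lnorm_seg_eq_sum`); §2 **SUP BOUND**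
`‖dbarLin L W Y c‖ ≤ (L + w·Csup(d,L))·s` for `‖Y(b)‖ ≤ s` on the `nbRad`-ball about `c₋`, `Csup = 1250(nbRad + L) + 8dL + 2L`
(`norm_dbarLin_le_sup`) — smooth directions are amplified by `L + O(a)` per step; §3 **`ℓ¹` BOUND ON THE TORUS**
`Σ_{y∈[0,M)^d} Σ_κ ‖dbarLin L W Y (L·y, κ)‖ ≤ (L∕L^d + w·Csup·d·(2nbRad+1)^d) · ‖Y‖_{ℓ¹([0,LM)^d)}` for an `LM`-periodic `Y`
(`sum_period_norm_dbarLin_le`; exact tiling `sum_blocks_eq`∕`blockSites_periodBox`∕`sum_periodBox_shift` for the main term,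
`AveragingDeficitPeriodicCounting.sum_periodBox_box_le` for the errors) — localised directions are CONTRACTED by
`L^{1−d} + O(a)` per step: (K3) of SHAPE `Statements/S6-Y7-SHAPE-v1.md` §2′ for the non-gauge part of the linearisation.

HONEST FRAMING: finite-`T⁴` kinematics of ONE block-averaging step on ONE lattice (rung (B)+1 — NOT infinite volume, NOT a
mass gap, NOT Clay); linear estimates at one background; nothing of NE3 is claimed (NE3-E stays CONDITIONAL on the co-owners'
⟨named structures⟩; the k-level L7(a) stays OPEN ∕ road P3's typed binder — (K4)–(K6) are not here); no `BetaPertH`, no (B),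
no G-an2-4; no printed sentence is a hypothesis ([cite:] tags are context).  PLACEMENT (human rule 2026-08-19): our work,
under `Summits/QuantumFields/BalabanUV/`.
-/

set_option autoImplicit false

open scoped BigOperators Matrix.Norms.L2Operator Topology
open NormedSpace Finset Filter Metric

namespace Summit.QuantumFields.BalabanUV.T4Continuum.BlockAverageDbarLinNorms

open Literature.MathematicalPhysics.QuantumFieldTheory.Balaban1983to89
open B7Prop1Explicit B7Prop2Explicit MatrixLog UnitaryModel
open T4AveragingDeficitWall hiding Site Plane Plaq Bond
open T4AveragingDeficitWallBoundary (periodBox blockSites_periodBox sum_blocks_eq sum_periodBox_shift)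
open AveragingDeficitPeriodicCounting (IsPeriodicDir)
open AveragingDeficitTransport (lnorm lnorm_nil lnorm_cons)
open AveragingDeficitSideDeriv (loopWord length_loopWord)
open BlockAverageVaryHolo (nbRad length_loopWord_le l1_sub_self)
open BlockAveragePushDirSplit (dbarLin)
open BlockAverageDbarLinBound (loopL1 treeL1' segL1 lnorm_nonneg norm_dbarLin_le)

noncomputable section

variable {d : ℕ} {n : Type*} [Fintype n] [DecidableEq n]

/-! ## §1 Word weights against the sup, against box sums, and the straight segment exactly -/

/-- A word weight against the sup: if `‖Y(b)‖ ≤ s` on the bonds of the `R`-ball about `q` and `|x − q|₁ + |Γ| ≤ R`, then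
`Σ_{b⊂Γ}‖Y(b)‖ ≤ |Γ|·s`. [folklore] -/
theorem lnorm_le_length_mul_sup (Y : Site d → Fin d → Matrix n n ℂ) {q : Site d} {R : ℕ} {s : ℝ}
    (hY : ∀ (x : Site d) (μ : Fin d), l1 (x - q) ≤ R → ‖Y x μ‖ ≤ s) :
    ∀ (w : List (Letter d)) (x : Site d), l1 (x - q) + w.length ≤ R → lnorm Y x w ≤ w.length * s
  | [], x, _ => by simp
  | l :: w, x, hx => by
    rw [List.length_cons] at hx
    have hx' : l1 (x + l.vec - q) + w.length ≤ R := by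
      have := l1_add_le (x - q) l.vec
      rw [l1_vec, show x - q + l.vec = x + l.vec - q by abel] at this
      omega
    have ih := lnorm_le_length_mul_sup Y hY w (x + l.vec) hx'
    rw [lnorm_cons, List.length_cons, Nat.cast_succ, add_mul, one_mul, add_comm ((w.length : ℝ) * s)]
    refine add_le_add ?_ ih
    split
    · exact hY x l.1 (by omega)
    · exact hY (x + l.vec) l.1 (by omega)

/-- The weight of the straight segment is the plain sum `Σ_{i<L} ‖Y(p + ie_κ, κ)‖`. [folklore] -/
theorem lnorm_seg_eq_sum (Y : Site d → Fin d → Matrix n n ℂ) (κ : Fin d) :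
    ∀ (L : ℕ) (p : Site d), lnorm Y p (seg κ (L : ℤ)) = ∑ i ∈ Finset.range L, ‖Y (p + (i : ℤ) • e κ) κ‖
  | 0, p => by simp
  | L + 1, p => by
    rw [seg_natCast, List.replicate_succ, lnorm_cons, ← seg_natCast, lnorm_seg_eq_sum Y κ L (p + Letter.vec (κ, true)),
      Finset.sum_range_succ', add_comm]
    simp only [Letter.vec_true, if_true, Nat.cast_zero, zero_smul, add_zero, Nat.cast_succ, add_smul, one_smul]
    congr 1
    refine Finset.sum_congr rfl fun i _ => ?_
    congr 2
    abel

/-- `|L·e_κ|₁ = L`. [folklore] -/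
theorem l1_natCast_smul_e (L : ℕ) (κ : Fin d) : l1 ((L : ℤ) • e κ : Site d) = L := by
  simp [l1, Pi.smul_apply, e_apply, mul_ite, mul_one, mul_zero, apply_ite Int.natAbs,
    Int.natAbs_natCast, Int.natAbs_zero, Finset.sum_ite_eq', Finset.mem_univ]

/-! ## §2 The sup bound -/

/-- **SUP → SUP: `‖dbarLin L W Y c‖ ≤ (L + w·(1250(nbRad + L) + 8dL + 2L))·s`** on `U(N)` data with loop variables at `c` within
`w ≤ 1∕32` of `1`, for a direction with `‖Y(b)‖ ≤ s` on the bonds within `l¹`-distance `nbRad d L` of `c₋`. [folklore] -/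
theorem norm_dbarLin_le_sup [Nonempty n] (L : ℕ) (hL : 1 ≤ L) {W : Site d → Fin d → (Matrix n n ℂ)ˣ} (hW : IsUnitaryCfg W)
    (Y : Site d → Fin d → Matrix n n ℂ) (q : Site d) (κ : Fin d) {w : ℝ} (hw : w ≤ 1 / 32)
    (hWcx : ∀ r : Fin d → Fin L, ‖((Wcx L W q κ (boxVec L r) : (Matrix n n ℂ)ˣ) : Matrix n n ℂ) - 1‖ ≤ w)
    {s : ℝ} (hY : ∀ (x : Site d) (μ : Fin d), l1 (x - q) ≤ nbRad d L → ‖Y x μ‖ ≤ s) :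
    ‖dbarLin L W Y q κ‖ ≤ ((L : ℝ) + w * (1250 * ((nbRad d L : ℝ) + L) + 8 * (d * L) + 2 * L)) * s := by
  have hw0 : 0 ≤ w := (norm_nonneg _).trans (hWcx fun _ => ⟨0, hL⟩)
  have hs : 0 ≤ s := (norm_nonneg _).trans (hY q κ (by rw [l1_sub_self]; exact Nat.zero_le _))
  have hwt := BlockAveragePushDirSplit.sum_blockWeight_eq_one (d := d) L hL
  -- the four local weights against the sup
  have hseg0 : lnorm Y q (seg κ L) ≤ L * s := by
    have h := lnorm_le_length_mul_sup Y hY (seg κ (L : ℤ)) q (by rw [l1_sub_self, length_seg, Int.natAbs_natCast, nbRad]; omega)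
    rwa [length_seg, Int.natAbs_natCast] at h
  have hsegL1 : segL1 L Y q κ ≤ L * s := by
    unfold segL1
    calc _ ≤ ∑ _r : Fin d → Fin L, ((L : ℝ) ^ d)⁻¹ * (L * s) := by
          refine Finset.sum_le_sum fun r _ => mul_le_mul_of_nonneg_left ?_ (by positivity)
          have h := lnorm_le_length_mul_sup Y hY (seg κ (L : ℤ)) (q + boxVec L r) (by
            rw [add_sub_cancel_left, length_seg, Int.natAbs_natCast, nbRad]
            have := l1_boxVec_le L r; omega)
          rwa [length_seg, Int.natAbs_natCast] at h
      _ = L * s := by rw [← Finset.sum_mul, hwt, one_mul]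
  have hloopL1 : loopL1 L Y q κ ≤ (nbRad d L : ℝ) * s := by
    unfold loopL1
    calc _ ≤ ∑ _r : Fin d → Fin L, ((L : ℝ) ^ d)⁻¹ * ((nbRad d L : ℝ) * s) := by
          refine Finset.sum_le_sum fun r _ => mul_le_mul_of_nonneg_left ?_ (by positivity)
          have h := lnorm_le_length_mul_sup Y hY (loopWord L κ (boxVec L r)) q (by
            rw [l1_sub_self, zero_add]; exact length_loopWord_le L κ r)
          exact h.trans (mul_le_mul_of_nonneg_right (by exact_mod_cast length_loopWord_le L κ r) hs)
      _ = (nbRad d L : ℝ) * s := by rw [← Finset.sum_mul, hwt, one_mul]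
  have htreeL1 : treeL1' L Y q κ ≤ (d * L : ℝ) * s := by
    unfold treeL1'
    calc _ ≤ ∑ _r : Fin d → Fin L, ((L : ℝ) ^ d)⁻¹ * ((d * L : ℝ) * s) := by
          refine Finset.sum_le_sum fun r _ => mul_le_mul_of_nonneg_left ?_ (by positivity)
          have hlen : (treeWord (boxVec L r)).length ≤ d * L := by rw [length_treeWord]; exact l1_boxVec_le L r
          have hl := l1_natCast_smul_e (d := d) L κ
          have h := lnorm_le_length_mul_sup Y hY (treeWord (boxVec L r)) (q + (L : ℤ) • e κ) (by
            rw [add_sub_cancel_left, hl, length_treeWord, nbRad]; have := l1_boxVec_le L r; omega)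
          exact h.trans (mul_le_mul_of_nonneg_right (by exact_mod_cast hlen) hs)
      _ = (d * L : ℝ) * s := by rw [← Finset.sum_mul, hwt, one_mul]
  have h := norm_dbarLin_le L hL hW Y q κ hw hWcx
  refine h.trans ?_
  have h1250 : (0 : ℝ) ≤ 1250 := by norm_num
  nlinarith [mul_nonneg hw0 hs, hsegL1, hloopL1, htreeL1, hseg0, hs, hw0]

/-! ## §3 The `ℓ¹` bound on the torus -/

/-- **`ℓ¹ → ℓ¹` ON THE TORUS: `Σ_{y∈[0,M)^d} Σ_κ ‖dbarLin L W Y (L·y, κ)‖ ≤ (L∕L^d + w·Csup·d·(2nbRad+1)^d)·‖Y‖_{ℓ¹([0,LM)^d)}`**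
for a `U(N)`-valued `W` all of whose loop variables are within `w ≤ 1∕32` of `1` and an `LM`-periodic direction `Y`
(`Csup = 1250(nbRad + L) + 8dL + 2L`).  The main term is counted EXACTLY (every fine bond lies on `L` straight segments of
weight `L^{−d}`); the `O(w)` errors through the box multiplicity `(2nbRad+1)^d`. [folklore] -/
theorem sum_period_norm_dbarLin_le [Nonempty n] {L M : ℕ} (hL : 1 ≤ L) (hM : 1 ≤ M)
    {W : Site d → Fin d → (Matrix n n ℂ)ˣ} (hW : IsUnitaryCfg W) {w : ℝ} (hw0 : 0 ≤ w) (hw : w ≤ 1 / 32)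
    (hWcx : ∀ (q : Site d) (κ : Fin d) (r : Fin d → Fin L), ‖((Wcx L W q κ (boxVec L r) : (Matrix n n ℂ)ˣ) : Matrix n n ℂ) - 1‖ ≤ w)
    (Y : Site d → Fin d → Matrix n n ℂ) (hY : IsPeriodicDir Y ((L : ℤ) * M)) :
    ∑ y ∈ periodBox M, ∑ κ : Fin d, ‖dbarLin L W Y ((L : ℤ) • y) κ‖
      ≤ ((L : ℝ) / (L : ℝ) ^ d
          + w * ((1250 * ((nbRad d L : ℝ) + L) + 8 * (d * L) + 2 * L) * (d * (2 * nbRad d L + 1) ^ d)))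
        * dirL1 Y (periodBox (L * M)) := by
  have hLM : 1 ≤ L * M := Nat.one_le_iff_ne_zero.mpr (Nat.mul_ne_zero (by omega) (by omega))
  have hwt := BlockAveragePushDirSplit.sum_blockWeight_eq_one (d := d) L hL
  have hper : ∀ (κ : Fin d) (x : Site d) (i : Fin d), ‖Y (x + ((L * M : ℕ) : ℤ) • e i) κ‖ = ‖Y x κ‖ := by
    intro κ x i
    rw [show (((L * M : ℕ) : ℤ)) = (L : ℤ) * M by push_cast; ring, hY x i κ]
  -- (1) pointwise
  have hpt : ∀ (y : Site d) (κ : Fin d), ‖dbarLin L W Y ((L : ℤ) • y) κ‖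
      ≤ segL1 L Y ((L : ℤ) • y) κ
        + w * ((1250 * ((nbRad d L : ℝ) + L) + 8 * (d * L) + 2 * L) * dirL1 Y (box (nbRad d L) ((L : ℤ) • y))) := by
    intro y κ
    set q : Site d := (L : ℤ) • y with hq
    have h := norm_dbarLin_le L hL hW Y q κ hw (hWcx q κ)
    refine h.trans (add_le_add le_rfl (mul_le_mul_of_nonneg_left ?_ hw0))
    have hD0 : 0 ≤ dirL1 Y (box (nbRad d L) q) := by
      unfold dirL1; exact Finset.sum_nonneg fun _ _ => Finset.sum_nonneg fun _ _ => norm_nonneg _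
    -- the local weights against the box sum
    have hseg0 : lnorm Y q (seg κ L) ≤ L * dirL1 Y (box (nbRad d L) q) := by
      have h := AveragingDeficitPlaqLin.lnorm_le_region Y (z := q) (q := q) (R := nbRad d L) (seg κ (L : ℤ))
        (by rw [l1_sub_self, length_seg, Int.natAbs_natCast, nbRad]; omega)
      rwa [length_seg, Int.natAbs_natCast] at h
    have hloopL1 : loopL1 L Y q κ ≤ (nbRad d L : ℝ) * dirL1 Y (box (nbRad d L) q) := by
      unfold loopL1
      calc _ ≤ ∑ _r : Fin d → Fin L, ((L : ℝ) ^ d)⁻¹ * ((nbRad d L : ℝ) * dirL1 Y (box (nbRad d L) q)) := by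
            refine Finset.sum_le_sum fun r _ => mul_le_mul_of_nonneg_left ?_ (by positivity)
            have h := AveragingDeficitPlaqLin.lnorm_le_region Y (z := q) (q := q) (R := nbRad d L)
              (loopWord L κ (boxVec L r)) (by rw [l1_sub_self, zero_add]; exact length_loopWord_le L κ r)
            exact h.trans (mul_le_mul_of_nonneg_right (by exact_mod_cast length_loopWord_le L κ r) hD0)
        _ = _ := by rw [← Finset.sum_mul, hwt, one_mul]
    have htreeL1 : treeL1' L Y q κ ≤ (d * L : ℝ) * dirL1 Y (box (nbRad d L) q) := by
      unfold treeL1'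
      calc _ ≤ ∑ _r : Fin d → Fin L, ((L : ℝ) ^ d)⁻¹ * ((d * L : ℝ) * dirL1 Y (box (nbRad d L) q)) := by
            refine Finset.sum_le_sum fun r _ => mul_le_mul_of_nonneg_left ?_ (by positivity)
            have hlen : (treeWord (boxVec L r)).length ≤ d * L := by rw [length_treeWord]; exact l1_boxVec_le L r
            have hl := l1_natCast_smul_e (d := d) L κ
            have h := AveragingDeficitPlaqLin.lnorm_le_region Y (z := q) (q := q + (L : ℤ) • e κ) (R := nbRad d L)
              (treeWord (boxVec L r)) (by rw [add_sub_cancel_left, hl, length_treeWord, nbRad]; have := l1_boxVec_le L r; omega)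
            exact h.trans (mul_le_mul_of_nonneg_right (by exact_mod_cast hlen) hD0)
        _ = _ := by rw [← Finset.sum_mul, hwt, one_mul]
    nlinarith [hseg0, hloopL1, htreeL1, hD0]
  -- (2) the main term, counted exactly
  set f : Fin d → ℕ → Site d → (Fin d → Fin L) → ℝ :=
    fun κ i y r => ‖Y ((L : ℤ) • y + boxVec L r + (i : ℤ) • e κ) κ‖ with hf
  have htile : ∀ (κ : Fin d) (i : ℕ),
      ∑ y ∈ periodBox M, ∑ r : Fin d → Fin L, f κ i y r = ∑ x ∈ periodBox (L * M), ‖Y x κ‖ := by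
    intro κ i
    simp only [hf]
    rw [sum_blocks_eq L hL (periodBox M) (fun x => ‖Y (x + (i : ℤ) • e κ) κ‖), blockSites_periodBox L M hL]
    exact sum_periodBox_shift (L * M) hLM (g := fun x => ‖Y x κ‖) (hper κ) ((i : ℤ) • e κ)
  have hmain : ∑ y ∈ periodBox M, ∑ κ : Fin d, segL1 L Y ((L : ℤ) • y) κ = (L : ℝ) / (L : ℝ) ^ d * dirL1 Y (periodBox (L * M)) := by
    set w' : ℝ := ((L : ℝ) ^ d)⁻¹ with hw'
    calc ∑ y ∈ periodBox M, ∑ κ : Fin d, segL1 L Y ((L : ℤ) • y) κ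
        = ∑ y ∈ periodBox M, ∑ κ : Fin d, ∑ r : Fin d → Fin L, w' * ∑ i ∈ Finset.range L, f κ i y r := by
          refine Finset.sum_congr rfl fun y _ => Finset.sum_congr rfl fun κ _ => ?_
          unfold segL1
          exact Finset.sum_congr rfl fun r _ => by rw [lnorm_seg_eq_sum]
      _ = ∑ κ : Fin d, ∑ y ∈ periodBox M, ∑ r : Fin d → Fin L, w' * ∑ i ∈ Finset.range L, f κ i y r := Finset.sum_comm
      _ = ∑ κ : Fin d, ∑ i ∈ Finset.range L, w' * ∑ y ∈ periodBox M, ∑ r : Fin d → Fin L, f κ i y r := by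
          refine Finset.sum_congr rfl fun κ _ => ?_
          calc ∑ y ∈ periodBox M, ∑ r : Fin d → Fin L, w' * ∑ i ∈ Finset.range L, f κ i y r
              = ∑ y ∈ periodBox M, ∑ r : Fin d → Fin L, ∑ i ∈ Finset.range L, w' * f κ i y r := by
                simp only [Finset.mul_sum]
            _ = ∑ y ∈ periodBox M, ∑ i ∈ Finset.range L, ∑ r : Fin d → Fin L, w' * f κ i y r :=
                Finset.sum_congr rfl fun y _ => Finset.sum_comm
            _ = ∑ i ∈ Finset.range L, ∑ y ∈ periodBox M, ∑ r : Fin d → Fin L, w' * f κ i y r := Finset.sum_comm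
            _ = ∑ i ∈ Finset.range L, w' * ∑ y ∈ periodBox M, ∑ r : Fin d → Fin L, f κ i y r := by
                simp only [Finset.mul_sum]
      _ = ∑ κ : Fin d, ∑ _i ∈ Finset.range L, w' * ∑ x ∈ periodBox (L * M), ‖Y x κ‖ := by
          refine Finset.sum_congr rfl fun κ _ => Finset.sum_congr rfl fun i _ => ?_
          rw [htile κ i]
      _ = (L : ℝ) / (L : ℝ) ^ d * dirL1 Y (periodBox (L * M)) := by
          simp only [Finset.sum_const, Finset.card_range, nsmul_eq_mul, hw']
          rw [dirL1, Finset.sum_comm, Finset.mul_sum]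
          refine Finset.sum_congr rfl fun κ _ => ?_
          ring
  -- (3) the errors, through the box multiplicity
  have hbox : ∑ y ∈ periodBox M, dirL1 Y (box (nbRad d L) ((L : ℤ) • y))
      ≤ (2 * nbRad d L + 1) ^ d * dirL1 Y (periodBox (L * M)) := by
    unfold dirL1
    refine AveragingDeficitPeriodicCounting.sum_periodBox_box_le L M hL hM (nbRad d L)
      (fun _ => Finset.sum_nonneg fun _ _ => norm_nonneg _) fun x κ => ?_
    rw [AveragingDeficitPeriodicCounting.natCast_mul_period]
    exact Finset.sum_congr rfl fun μ _ => by rw [hY x κ μ]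
  -- (4) assemble
  set C : ℝ := 1250 * ((nbRad d L : ℝ) + L) + 8 * (d * L) + 2 * L with hC
  have hC0 : 0 ≤ C := by rw [hC]; positivity
  calc ∑ y ∈ periodBox M, ∑ κ : Fin d, ‖dbarLin L W Y ((L : ℤ) • y) κ‖
      ≤ ∑ y ∈ periodBox M, ∑ κ : Fin d,
          (segL1 L Y ((L : ℤ) • y) κ + w * (C * dirL1 Y (box (nbRad d L) ((L : ℤ) • y)))) :=
        Finset.sum_le_sum fun y _ => Finset.sum_le_sum fun κ _ => hpt y κ
    _ = ∑ y ∈ periodBox M, ∑ κ : Fin d, segL1 L Y ((L : ℤ) • y) κ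
        + w * C * (d * ∑ y ∈ periodBox M, dirL1 Y (box (nbRad d L) ((L : ℤ) • y))) := by
        rw [Finset.mul_sum]
        simp only [Finset.sum_add_distrib, Finset.sum_const, Finset.card_univ, Fintype.card_fin, nsmul_eq_mul]
        congr 1
        rw [Finset.mul_sum]
        refine Finset.sum_congr rfl fun y _ => ?_
        ring
    _ ≤ (L : ℝ) / (L : ℝ) ^ d * dirL1 Y (periodBox (L * M))
        + w * C * (d * ((2 * nbRad d L + 1) ^ d * dirL1 Y (periodBox (L * M)))) := by
        rw [hmain]
        refine add_le_add le_rfl (mul_le_mul_of_nonneg_left (mul_le_mul_of_nonneg_left hbox (Nat.cast_nonneg _)) ?_)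
        positivity
    _ = ((L : ℝ) / (L : ℝ) ^ d + w * (C * (d * (2 * nbRad d L + 1) ^ d))) * dirL1 Y (periodBox (L * M)) := by ring

end

end Summit.QuantumFields.BalabanUV.T4Continuum.BlockAverageDbarLinNorms
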